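import Summits.Ventures.Crystal3D.Theorems.StickyWulffConstantGenericWallFloorCubicCoords
import Summits.Ventures.Crystal3D.Theorems.StickyWulffConstantNoReconstructionGainOffLattice
import Summits.Ventures.Crystal3D.Theorems.StickyWulffConstantGenericWallFloorShellCapture
import HarnessLib

/-!
# Skew roots of a translation offset, I: the real trichotomy and the 3-adic genericity of the integral case

HONEST FRAMING. Part of the venture `Summits/Ventures/Crystal3D` (cell `crystal3d-full`), helper
`--supports` the crux `CoaxialWallLaw` (stmt-Ventures-19481, `route-Ventures-StickyWulffConstant`),
REGISTERED line `WallLedgerF` (planner cf-p1 gen 16), open stub `stub_coaxialTwoSlabAdhesion`.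
RUNG CREDIT ONLY — pure lattice arithmetic, nothing about packings.

For a TRANSLATION pair `Λ₁ = A₁·Λ₀ + t₁`, `Λ₂ = A₁·Λ₀ + t₂` the NET word automaton of 19481-p2 (`…WordTransPlane`)
charges the wall through any ROOT slot `w` whose orthogonal slot `s ⊥ w` is SKEW for the offset
`τ = A₁⁻¹(t₂ − t₁)` (`2⟪τ, s⟫ ∉ ℤ`).  In the cubic coordinates `p = √2 · cubicCoords τ` (slots `(±eᵢ ± eⱼ)/√2`,
`2⟪τ, slot⟫ = ±pᵢ ± pⱼ`) the skew pattern of `τ` is the set of non-integers among the six numbers `pᵢ ± pⱼ`.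

* `real_skew_trichotomy` — for three reals `a, b, c`: (A) all six `x ± y ∈ ℤ`; or (B) for one of them all
  four sums/differences with the other two are non-integers; or (C) for one sign vector `ε` the three
  numbers `εᵢ xᵢ + εⱼ xⱼ` are non-integers.  (Dead pairs propagate; two half-alive pairs with a common index
  kill a root of the third.)
* `generic_of_allInt` — in case (A), an offset `τ ∉ Λ₀` is 3-ADICALLY GENERIC: `3^k τ ∉ Λ₀` for all `k`
  (`2pᵢ ∈ ℤ` and `3^k pᵢ ∈ ℤ` force `pᵢ ∈ ℤ`; the parity of `Σ pᵢ` is that of `Σ 3^k pᵢ`; sites are exactly the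
  even integer cubic triples, `exists_even_cubic_of_mem_fcc` / `mem_fcc_of_even_cubic`) — the hypothesis of
  19481-p1's `coaxialTwoSlabAdhesion_general_trans_generic`.

Part II (`…CoaxialWallLawSkewRoots`) turns (B) and (C) into root slots; both parts are consumed by the union
theorem `…CoaxialWallLawPosCharge`.  WHAT THIS IS NOT: anything about walls or packings; F-C1 not moved.
-/

noncomputable section

namespace Summit.Ventures.Crystal3D.Theorems

open Summit.Ventures.Crystal3D Finset Matrix NearIdentity
open Literature.MathematicalPhysics.StatisticalMechanics (barlowPos barlowStacking fccStacking
  constHagg IsHaggSeq barlowPos_mem)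
open scoped InnerProductSpace

/-! ### 1. Integrality arithmetic and the real trichotomy -/

/-- Sums of integers are integers (real form). -/
theorem isInt_add {x y : ℝ} (hx : ∃ z : ℤ, x = z) (hy : ∃ z : ℤ, y = z) : ∃ z : ℤ, x + y = z := by
  obtain ⟨a, rfl⟩ := hx; obtain ⟨b, rfl⟩ := hy; exact ⟨a + b, by push_cast; ring⟩

/-- Differences of integers are integers (real form). -/
theorem isInt_sub {x y : ℝ} (hx : ∃ z : ℤ, x = z) (hy : ∃ z : ℤ, y = z) : ∃ z : ℤ, x - y = z := by
  obtain ⟨a, rfl⟩ := hx; obtain ⟨b, rfl⟩ := hy; exact ⟨a - b, by push_cast; ring⟩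

/-- Negatives of integers are integers (real form, iff). -/
theorem isInt_neg_iff {x : ℝ} : (∃ z : ℤ, -x = z) ↔ ∃ z : ℤ, x = z := by
  constructor
  · rintro ⟨a, ha⟩; exact ⟨-a, by push_cast; linarith⟩
  · rintro ⟨a, rfl⟩; exact ⟨-a, by push_cast; ring⟩

/-- A sign times a non-integer is a non-integer. -/
theorem not_isInt_sign_mul {η x : ℝ} (hη : η = 1 ∨ η = -1) (hx : ¬ ∃ z : ℤ, x = z) :
    ¬ ∃ z : ℤ, η * x = z := by
  rcases hη with rfl | rfl
  · rwa [one_mul]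
  · rwa [neg_one_mul, isInt_neg_iff]

/-- **Dead pairs propagate.**  If `a + b, a − b ∈ ℤ` then the pairs `{a,c}` and `{b,c}` are both dead
(all four of `a ± c`, `b ± c` integers) or both fully alive (none of them an integer). -/
theorem deadPair_propagate (a b c : ℝ) (hs : ∃ z : ℤ, a + b = z) (hd : ∃ z : ℤ, a - b = z) :
    ((∃ z : ℤ, a + c = z) ∧ (∃ z : ℤ, a - c = z) ∧ (∃ z : ℤ, b + c = z) ∧ (∃ z : ℤ, b - c = z)) ∨
    ((¬ ∃ z : ℤ, a + c = z) ∧ (¬ ∃ z : ℤ, a - c = z) ∧ (¬ ∃ z : ℤ, b + c = z) ∧ (¬ ∃ z : ℤ, b - c = z)) := by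
  by_cases h : ∃ z : ℤ, a + c = z
  · refine Or.inl ⟨h, ?_, ?_, ?_⟩
    · have := isInt_sub (isInt_add hs hd) h
      obtain ⟨z, hz⟩ := this; exact ⟨z, by linarith⟩
    · obtain ⟨z, hz⟩ := isInt_sub h hd; exact ⟨z, by linarith⟩
    · obtain ⟨z, hz⟩ := isInt_sub hs h; exact ⟨z, by linarith⟩
  · refine Or.inr ⟨h, fun h' => h ?_, fun h' => h ?_, fun h' => h ?_⟩
    · obtain ⟨z, hz⟩ := isInt_sub (isInt_add hs hd) h'; exact ⟨z, by linarith⟩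
    · obtain ⟨z, hz⟩ := isInt_add h' hd; exact ⟨z, by linarith⟩
    · obtain ⟨z, hz⟩ := isInt_sub hs h'; exact ⟨z, by linarith⟩

/-- **A half-alive pair has a sign.**  If exactly one of `x + y`, `x − y` is an integer, then for some sign
`η`, `x − η y ∈ ℤ` and `x + η y ∉ ℤ`. -/
theorem halfPair_sign (x y : ℝ) (hnd : ¬ ((∃ z : ℤ, x + y = z) ∧ (∃ z : ℤ, x - y = z)))
    (hna : ¬ ((¬ ∃ z : ℤ, x + y = z) ∧ (¬ ∃ z : ℤ, x - y = z))) :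
    ∃ η : ℝ, (η = 1 ∨ η = -1) ∧ (∃ z : ℤ, x - η * y = z) ∧ ¬ ∃ z : ℤ, x + η * y = z := by
  by_cases h : ∃ z : ℤ, x + y = z
  · refine ⟨-1, Or.inr rfl, by simpa using h, ?_⟩
    intro h'; exact hnd ⟨h, by simpa [sub_eq_add_neg] using h'⟩
  · have h' : ∃ z : ℤ, x - y = z := by
      by_contra h'; exact hna ⟨h, h'⟩
    exact ⟨1, Or.inl rfl, by simpa using h', by simpa using h⟩

/-- **Two half-alive pairs with a common index kill a root of the third pair.**  If `a − η c ∈ ℤ` and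
`b − η' c ∈ ℤ` (`η, η'` signs) then `a − η η' b ∈ ℤ`. -/
theorem isInt_sub_of_common (a b c η η' : ℝ) (hη : η = 1 ∨ η = -1) (hη' : η' = 1 ∨ η' = -1)
    (h₁ : ∃ z : ℤ, a - η * c = z) (h₂ : ∃ z : ℤ, b - η' * c = z) : ∃ z : ℤ, a - η * η' * b = z := by
  obtain ⟨z₁, hz₁⟩ := h₁
  obtain ⟨z₂, hz₂⟩ := h₂
  rcases hη with rfl | rfl <;> rcases hη' with rfl | rfl
  · exact ⟨z₁ - z₂, by push_cast; linarith⟩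
  · exact ⟨z₁ + z₂, by push_cast; linarith⟩
  · exact ⟨z₁ + z₂, by push_cast; linarith⟩
  · exact ⟨z₁ - z₂, by push_cast; linarith⟩

/-- **The real trichotomy.**  For three reals `a, b, c` (the cubic coordinates of an offset): (A) all six
`x ± y` are integers; or (B) for one of them, say `x`, the four numbers `x ± y`, `x ± z` with the other two are
all non-integers; or (C) for one sign vector `(ε₀, ε₁, ε₂)` the three numbers `εᵢ xᵢ + εⱼ xⱼ` are non-integers. -/
theorem real_skew_trichotomy (a b c : ℝ) :
    ((∃ z : ℤ, a + b = z) ∧ (∃ z : ℤ, a - b = z) ∧ (∃ z : ℤ, a + c = z) ∧ (∃ z : ℤ, a - c = z) ∧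
      (∃ z : ℤ, b + c = z) ∧ (∃ z : ℤ, b - c = z)) ∨
    ((¬ ∃ z : ℤ, a + b = z) ∧ (¬ ∃ z : ℤ, a - b = z) ∧ (¬ ∃ z : ℤ, a + c = z) ∧ (¬ ∃ z : ℤ, a - c = z)) ∨
    ((¬ ∃ z : ℤ, a + b = z) ∧ (¬ ∃ z : ℤ, a - b = z) ∧ (¬ ∃ z : ℤ, b + c = z) ∧ (¬ ∃ z : ℤ, b - c = z)) ∨
    ((¬ ∃ z : ℤ, a + c = z) ∧ (¬ ∃ z : ℤ, a - c = z) ∧ (¬ ∃ z : ℤ, b + c = z) ∧ (¬ ∃ z : ℤ, b - c = z)) ∨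
    (∃ ε₀ ε₁ ε₂ : ℝ, (ε₀ = 1 ∨ ε₀ = -1) ∧ (ε₁ = 1 ∨ ε₁ = -1) ∧ (ε₂ = 1 ∨ ε₂ = -1) ∧
      (¬ ∃ z : ℤ, ε₀ * a + ε₁ * b = z) ∧ (¬ ∃ z : ℤ, ε₀ * a + ε₂ * c = z) ∧
      (¬ ∃ z : ℤ, ε₁ * b + ε₂ * c = z)) := by
  -- a dead pair decides everything
  by_cases d01 : (∃ z : ℤ, a + b = z) ∧ (∃ z : ℤ, a - b = z)
  · rcases deadPair_propagate a b c d01.1 d01.2 with h | h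
    · exact Or.inl ⟨d01.1, d01.2, h.1, h.2.1, h.2.2.1, h.2.2.2⟩
    · exact Or.inr (Or.inr (Or.inr (Or.inl ⟨h.1, h.2.1, h.2.2.1, h.2.2.2⟩)))
  by_cases d02 : (∃ z : ℤ, a + c = z) ∧ (∃ z : ℤ, a - c = z)
  · rcases deadPair_propagate a c b d02.1 d02.2 with h | h
    · exact absurd ⟨h.1, h.2.1⟩ d01
    · refine Or.inr (Or.inr (Or.inl ⟨h.1, h.2.1, ?_, ?_⟩))
      · intro h'; exact h.2.2.1 (by obtain ⟨z, hz⟩ := h'; exact ⟨z, by linarith⟩)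
      · intro h'; rw [← isInt_neg_iff] at h'
        exact h.2.2.2 (by obtain ⟨z, hz⟩ := h'; exact ⟨z, by linarith⟩)
  by_cases d12 : (∃ z : ℤ, b + c = z) ∧ (∃ z : ℤ, b - c = z)
  · rcases deadPair_propagate b c a d12.1 d12.2 with h | h
    · exact absurd ⟨by obtain ⟨z, hz⟩ := h.1; exact ⟨z, by linarith⟩,
        by rw [← isInt_neg_iff]; obtain ⟨z, hz⟩ := h.2.1; exact ⟨z, by linarith⟩⟩ d01
    · refine Or.inr (Or.inl ⟨?_, ?_, ?_, ?_⟩)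
      · intro h'; exact h.1 (by obtain ⟨z, hz⟩ := h'; exact ⟨z, by linarith⟩)
      · intro h'; rw [← isInt_neg_iff] at h'
        exact h.2.1 (by obtain ⟨z, hz⟩ := h'; exact ⟨z, by linarith⟩)
      · intro h'; exact h.2.2.1 (by obtain ⟨z, hz⟩ := h'; exact ⟨z, by linarith⟩)
      · intro h'; rw [← isInt_neg_iff] at h'
        exact h.2.2.2 (by obtain ⟨z, hz⟩ := h'; exact ⟨z, by linarith⟩)
  -- no dead pair: a fully alive pair next to another fully alive pair gives (B)
  by_cases f01 : (¬ ∃ z : ℤ, a + b = z) ∧ (¬ ∃ z : ℤ, a - b = z)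
  · by_cases f02 : (¬ ∃ z : ℤ, a + c = z) ∧ (¬ ∃ z : ℤ, a - c = z)
    · exact Or.inr (Or.inl ⟨f01.1, f01.2, f02.1, f02.2⟩)
    by_cases f12 : (¬ ∃ z : ℤ, b + c = z) ∧ (¬ ∃ z : ℤ, b - c = z)
    · exact Or.inr (Or.inr (Or.inl ⟨f01.1, f01.2, f12.1, f12.2⟩))
    -- pairs {a,c}, {b,c} half alive with common index `c`: contradiction with `f01`
    exfalso
    obtain ⟨η, hη, hi, -⟩ := halfPair_sign a c d02 f02
    obtain ⟨η', hη', hi', -⟩ := halfPair_sign b c d12 f12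
    have key := isInt_sub_of_common a b c η η' hη hη' hi hi'
    rcases hη with rfl | rfl <;> rcases hη' with rfl | rfl
    · exact f01.2 (by simpa using key)
    · exact f01.1 (by obtain ⟨z, hz⟩ := key; exact ⟨z, by linarith⟩)
    · exact f01.1 (by obtain ⟨z, hz⟩ := key; exact ⟨z, by linarith⟩)
    · exact f01.2 (by obtain ⟨z, hz⟩ := key; exact ⟨z, by linarith⟩)
  by_cases f02 : (¬ ∃ z : ℤ, a + c = z) ∧ (¬ ∃ z : ℤ, a - c = z)
  · by_cases f12 : (¬ ∃ z : ℤ, b + c = z) ∧ (¬ ∃ z : ℤ, b - c = z)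
    · exact Or.inr (Or.inr (Or.inr (Or.inl ⟨f02.1, f02.2, f12.1, f12.2⟩)))
    -- pairs {a,b}, {c,b} half alive with common index `b`: contradiction with `f02`
    exfalso
    obtain ⟨η, hη, hi, -⟩ := halfPair_sign a b d01 f01
    have d12' : ¬ ((∃ z : ℤ, c + b = z) ∧ (∃ z : ℤ, c - b = z)) := by
      intro h'; apply d12
      exact ⟨by obtain ⟨z, hz⟩ := h'.1; exact ⟨z, by linarith⟩,
        by rw [← isInt_neg_iff]; obtain ⟨z, hz⟩ := h'.2; exact ⟨z, by linarith⟩⟩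
    have f12' : ¬ ((¬ ∃ z : ℤ, c + b = z) ∧ (¬ ∃ z : ℤ, c - b = z)) := by
      intro h'; apply f12
      exact ⟨fun h'' => h'.1 (by obtain ⟨z, hz⟩ := h''; exact ⟨z, by linarith⟩),
        fun h'' => h'.2 (by rw [← isInt_neg_iff]; obtain ⟨z, hz⟩ := h''; exact ⟨z, by linarith⟩)⟩
    obtain ⟨η', hη', hi', -⟩ := halfPair_sign c b d12' f12'
    have key := isInt_sub_of_common a c b η η' hη hη' hi hi'
    rcases hη with rfl | rfl <;> rcases hη' with rfl | rfl
    · exact f02.2 (by simpa using key)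
    · exact f02.1 (by obtain ⟨z, hz⟩ := key; exact ⟨z, by linarith⟩)
    · exact f02.1 (by obtain ⟨z, hz⟩ := key; exact ⟨z, by linarith⟩)
    · exact f02.2 (by obtain ⟨z, hz⟩ := key; exact ⟨z, by linarith⟩)
  by_cases f12 : (¬ ∃ z : ℤ, b + c = z) ∧ (¬ ∃ z : ℤ, b - c = z)
  · -- pairs {b,a}, {c,a} half alive with common index `a`: contradiction with `f12`
    exfalso
    have d01' : ¬ ((∃ z : ℤ, b + a = z) ∧ (∃ z : ℤ, b - a = z)) := by
      intro h'; apply d01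
      exact ⟨by obtain ⟨z, hz⟩ := h'.1; exact ⟨z, by linarith⟩,
        by rw [← isInt_neg_iff]; obtain ⟨z, hz⟩ := h'.2; exact ⟨z, by linarith⟩⟩
    have f01' : ¬ ((¬ ∃ z : ℤ, b + a = z) ∧ (¬ ∃ z : ℤ, b - a = z)) := by
      intro h'; apply f01
      exact ⟨fun h'' => h'.1 (by obtain ⟨z, hz⟩ := h''; exact ⟨z, by linarith⟩),
        fun h'' => h'.2 (by rw [← isInt_neg_iff]; obtain ⟨z, hz⟩ := h''; exact ⟨z, by linarith⟩)⟩
    have d02' : ¬ ((∃ z : ℤ, c + a = z) ∧ (∃ z : ℤ, c - a = z)) := by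
      intro h'; apply d02
      exact ⟨by obtain ⟨z, hz⟩ := h'.1; exact ⟨z, by linarith⟩,
        by rw [← isInt_neg_iff]; obtain ⟨z, hz⟩ := h'.2; exact ⟨z, by linarith⟩⟩
    have f02' : ¬ ((¬ ∃ z : ℤ, c + a = z) ∧ (¬ ∃ z : ℤ, c - a = z)) := by
      intro h'; apply f02
      exact ⟨fun h'' => h'.1 (by obtain ⟨z, hz⟩ := h''; exact ⟨z, by linarith⟩),
        fun h'' => h'.2 (by rw [← isInt_neg_iff]; obtain ⟨z, hz⟩ := h''; exact ⟨z, by linarith⟩)⟩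
    obtain ⟨η, hη, hi, -⟩ := halfPair_sign b a d01' f01'
    obtain ⟨η', hη', hi', -⟩ := halfPair_sign c a d02' f02'
    have key := isInt_sub_of_common b c a η η' hη hη' hi hi'
    rcases hη with rfl | rfl <;> rcases hη' with rfl | rfl
    · exact f12.2 (by simpa using key)
    · exact f12.1 (by obtain ⟨z, hz⟩ := key; exact ⟨z, by linarith⟩)
    · exact f12.1 (by obtain ⟨z, hz⟩ := key; exact ⟨z, by linarith⟩)
    · exact f12.2 (by obtain ⟨z, hz⟩ := key; exact ⟨z, by linarith⟩)
  -- all three pairs half alive: (C)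
  obtain ⟨η, hη, hi, hn⟩ := halfPair_sign a c d02 f02
  obtain ⟨η', hη', hi', hn'⟩ := halfPair_sign b c d12 f12
  have key := isInt_sub_of_common a b c η η' hη hη' hi hi'
  have hn01 : ¬ ∃ z : ℤ, a + η * η' * b = z := by
    intro h'
    exact d01 (by
      rcases hη with rfl | rfl <;> rcases hη' with rfl | rfl
      · exact ⟨by simpa using h', by simpa using key⟩
      · exact ⟨by obtain ⟨z, hz⟩ := key; exact ⟨z, by linarith⟩,
          by obtain ⟨z, hz⟩ := h'; exact ⟨z, by linarith⟩⟩
      · exact ⟨by obtain ⟨z, hz⟩ := key; exact ⟨z, by linarith⟩,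
          by obtain ⟨z, hz⟩ := h'; exact ⟨z, by linarith⟩⟩
      · exact ⟨by obtain ⟨z, hz⟩ := h'; exact ⟨z, by linarith⟩,
          by obtain ⟨z, hz⟩ := key; exact ⟨z, by linarith⟩⟩)
  have hsign : η * η' = 1 ∨ η * η' = -1 := by
    rcases hη with rfl | rfl <;> rcases hη' with rfl | rfl <;> norm_num
  refine Or.inr (Or.inr (Or.inr (Or.inr ⟨1, η * η', η, Or.inl rfl, hsign, hη, ?_, ?_, ?_⟩)))
  · simpa using hn01
  · simpa using hn
  · -- `η η' b + η c = η η' (b + η' c)`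
    have e : η * η' * b + η * c = (η * η') * (b + η' * c) := by
      rcases hη' with rfl | rfl <;> ring
    rw [e]; exact not_isInt_sign_mul hsign hn'

/-! ### 2. Case (A): an all-integer skew pattern is 3-adically generic -/

/-- `√2 · cubicCoords` are the raw cubic functionals of `…CubicFrame`. -/
theorem sqrt_two_mul_cubicCoords (x : EuclideanSpace ℝ (Fin 3)) :
    Real.sqrt 2 * cubicCoords x 0 = x 0 + Real.sqrt 3 / 3 * x 1 - Real.sqrt (2 / 3) * x 2 ∧
    Real.sqrt 2 * cubicCoords x 1 = x 0 - Real.sqrt 3 / 3 * x 1 + Real.sqrt (2 / 3) * x 2 ∧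
    Real.sqrt 2 * cubicCoords x 2 = 2 * Real.sqrt 3 / 3 * x 1 + Real.sqrt (2 / 3) * x 2 := by
  have hs0 : Real.sqrt 2 ≠ 0 := by positivity
  refine ⟨?_, ?_, ?_⟩ <;> simp [cubicCoords] <;> field_simp

/-- **Sites have even integer cubic coordinates.** -/
theorem exists_even_cubic_of_mem_fcc {y : EuclideanSpace ℝ (Fin 3)} (hy : y ∈ fccStacking 1 (Real.sqrt (2 / 3))) :
    ∃ a b c : ℤ, Even (a + b + c) ∧ Real.sqrt 2 * cubicCoords y 0 = a ∧ Real.sqrt 2 * cubicCoords y 1 = b ∧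
      Real.sqrt 2 * cubicCoords y 2 = c := by
  obtain ⟨Z, hZ, h0, h1, h2⟩ := cubic_site_sub y hy 0 0 0
  rw [barlowPos_zero, sub_zero] at h0 h1 h2
  obtain ⟨e0, e1, e2⟩ := sqrt_two_mul_cubicCoords y
  exact ⟨Z.1, Z.2.1, Z.2.2, hZ, by rw [e0, h0], by rw [e1, h1], by rw [e2, h2]⟩

/-- **Even integer cubic coordinates are sites.** -/
theorem mem_fcc_of_even_cubic {y : EuclideanSpace ℝ (Fin 3)} (a b c : ℤ) (h : Even (a + b + c))
    (h0 : Real.sqrt 2 * cubicCoords y 0 = a) (h1 : Real.sqrt 2 * cubicCoords y 1 = b)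
    (h2 : Real.sqrt 2 * cubicCoords y 2 = c) : y ∈ fccStacking 1 (Real.sqrt (2 / 3)) := by
  obtain ⟨k, i, j, hij, hik, hjk⟩ := barlowPos_of_cubic a b c h
  obtain ⟨cA, cB, cC⟩ := cubic_barlowPos k i j
  obtain ⟨e0, e1, e2⟩ := sqrt_two_mul_cubicCoords (barlowPos 1 (Real.sqrt (2 / 3)) constHagg k i j)
  have hs0 : Real.sqrt 2 ≠ 0 := by positivity
  have heq : y = barlowPos 1 (Real.sqrt (2 / 3)) constHagg k i j := by
    apply cubicCoords_injective
    obtain ⟨f0, f1, f2⟩ := sqrt_two_mul_cubicCoords y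
    ext l
    fin_cases l
    · apply mul_left_cancel₀ hs0
      simp only [Fin.zero_eta, Fin.isValue]
      rw [h0, e0, cA, ← hij]; push_cast; ring
    · apply mul_left_cancel₀ hs0
      simp only [Fin.mk_one, Fin.isValue]
      rw [h1, e1, cB, ← hik]; push_cast; ring
    · apply mul_left_cancel₀ hs0
      simp only [Fin.reduceFinMk, Fin.isValue]
      rw [h2, e2, cC, ← hjk]; push_cast; ring
  rw [heq]; exact barlowPos_mem _ _ _

/-- `3^k` is odd. -/
theorem odd_three_pow (k : ℕ) : Odd ((3 : ℤ) ^ k) := Odd.pow (by decide)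

/-- **Case (A): all-integer skew pattern ⇒ 3-adically generic.**  If all six `p_i ± p_j` are integers
(`p = √2 · cubicCoords τ`) and `τ ∉ Λ₀`, then `3^k τ ∉ Λ₀` for every `k`. -/
theorem generic_of_allInt (τ : EuclideanSpace ℝ (Fin 3))
    (hall : ∀ i j : Fin 3, i ≠ j →
      (∃ z : ℤ, Real.sqrt 2 * cubicCoords τ i + Real.sqrt 2 * cubicCoords τ j = z) ∧
      (∃ z : ℤ, Real.sqrt 2 * cubicCoords τ i - Real.sqrt 2 * cubicCoords τ j = z))
    (hτ : τ ∉ fccStacking 1 (Real.sqrt (2 / 3))) (k : ℕ) :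
    ((3 : ℝ) ^ k) • τ ∉ fccStacking 1 (Real.sqrt (2 / 3)) := by
  intro hmem
  -- `2 p_i ∈ ℤ`
  have htwo : ∀ i : Fin 3, ∃ w : ℤ, 2 * (Real.sqrt 2 * cubicCoords τ i) = w := by
    intro i
    obtain ⟨j, hij⟩ : ∃ j : Fin 3, i ≠ j := ⟨i + 1, by fin_cases i <;> decide⟩
    obtain ⟨⟨z, hz⟩, ⟨z', hz'⟩⟩ := hall i j hij
    exact ⟨z + z', by push_cast; linarith⟩
  -- `3^k p_i ∈ ℤ` with an even sum
  obtain ⟨a, b, c, habc, ha, hb, hc⟩ := exists_even_cubic_of_mem_fcc hmem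
  rw [cubicCoords_smul] at ha hb hc
  simp only [Pi.smul_apply, smul_eq_mul] at ha hb hc
  -- hence `p_i ∈ ℤ`
  have hint : ∀ i : Fin 3, ∀ a' : ℤ, Real.sqrt 2 * ((3 : ℝ) ^ k * cubicCoords τ i) = a' →
      ∃ u : ℤ, Real.sqrt 2 * cubicCoords τ i = u ∧ (3 : ℤ) ^ k * u = a' := by
    intro i a' h
    obtain ⟨w, hw⟩ := htwo i
    have h3w : (3 : ℤ) ^ k * w = 2 * a' := by
      have : ((3 : ℤ) ^ k * w : ℤ) = ((2 * a' : ℤ) : ℝ) := by push_cast; rw [← hw, ← h]; ring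
      exact_mod_cast this
    have hweven : Even w := by
      have : Even ((3 : ℤ) ^ k * w) := ⟨a', by rw [h3w]; ring⟩
      rcases Int.even_mul.1 this with h3 | hw'
      · exact absurd h3 (Int.not_even_iff_odd.2 (odd_three_pow k))
      · exact hw'
    obtain ⟨u, hu⟩ := hweven
    refine ⟨u, ?_, ?_⟩
    · have : (2 : ℝ) * (Real.sqrt 2 * cubicCoords τ i) = 2 * u := by rw [hw, hu]; push_cast; ring
      linarith
    · have : (2 : ℤ) * ((3 : ℤ) ^ k * u) = 2 * a' := by rw [← h3w, hu]; ring
      linarith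
  obtain ⟨u0, hu0, hu0'⟩ := hint 0 a ha
  obtain ⟨u1, hu1, hu1'⟩ := hint 1 b hb
  obtain ⟨u2, hu2, hu2'⟩ := hint 2 c hc
  -- parity of the sum
  have heven : Even (u0 + u1 + u2) := by
    have : Even ((3 : ℤ) ^ k * (u0 + u1 + u2)) := by
      rw [mul_add, mul_add, hu0', hu1', hu2']; exact habc
    rcases Int.even_mul.1 this with h3 | h'
    · exact absurd h3 (Int.not_even_iff_odd.2 (odd_three_pow k))
    · exact h'
  exact hτ (mem_fcc_of_even_cubic u0 u1 u2 heven hu0 hu1 hu2)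

end Summit.Ventures.Crystal3D.Theorems

end
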